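import Summits.ResolutionOfSingularities.ResolutionOfSingularities.Theorems.EquisingularLiftEquisingularLiftNatTowerBEmbRoundCore
import Summits.ResolutionOfSingularities.ResolutionOfSingularities.Theorems.EquisingularLiftEquisingularLiftNatTowerBConeRoundCore
import Summits.ResolutionOfSingularities.ResolutionOfSingularities.Theorems.EquisingularLiftEquisingularLiftNatTowerEmbRoundOfFactAny
import Summits.ResolutionOfSingularities.ResolutionOfSingularities.Theorems.EquisingularLiftEquisingularLiftNatTowerSideFacts
import HarnessLib

/-!
# [OURS · L1 W4.5(b) · EL♮(3)] T23-A ENGINE — THE ROUNDS ON `Tower.InvB` AT THE DATUM «`V(𝓔)` IS `O`-FLAT», FROM (T-k), + THE TRIVIAL CONE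
# (rung `stub_elnat_defTowerBPointResolutionThree`, TWENTY-SIXTH registration)

res-L1-w45b-stub-4 g10 (T23-A ENGINE OWNER). Crux EL♮(3) = stmt-ResolutionOfSingularities-20148 (parent stmt-…-20038), route `EquisingularLift`, line `sections`.
OURS; NOT a statement of any manuscript; AI-written, weaker than expert review. DEF-FREE; no `sorry`; standard axioms;
`--supports stmt-ResolutionOfSingularities-20148 --as helper`.

WHAT (the B analogues of `Tower.inv₃_embRound_both_of_fact_any`, …NatTowerEmbRoundOfFactAny, for the assembly V10):
* `Tower.invB_embRound_of_fact_any` — the ČECH round of `TowerRoundB` (BOTH host menus: `H = E` running with shadow `K`, or `H ∈ Es` retained with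
  shadow `∅`) on `Tower.InvB` at `FE`, every stand-in of `Tower.invB_embRoundCore` discharged: centre by (T-k) `Tower.hCentre_of_fact_any`, shadows by
  res-D-pv-035's `Tower.hShadow_of_any` / `Tower.hShadowOld_of_any`, birth by `flat_exceptional_of_isBlowup_regularCentre`, iso-invariance of `FE`; with the
  V9 side facts of `K'`.
* `Tower.invB_coneRound_of_any` — the CONE-WITNESSED round (host = running `E`) via `Tower.invB_coneRoundCore`, `hEZ` by
  `Tower.subset_closure_diff_of_inv₃_coneWitness`.
* `Tower.invB_shadow_of_disjoint` — THE TRIVIAL CONE: if the running surface misses `closure K`, `Tower.InvB … E Es ∅ → Tower.InvB … E Es K` with the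
  unit ideal `𝒦 := ⊤` as the cone's model on `V := (closure K)ᶜ ⊇ E` ((k-ii-loc) is LOCAL; the pair `V(𝓔) ∩ V(⊤)` is empty: flat, vacuously regular,
  `isEffectiveCartier_top`). Serves `TowerRoundB`'s second-disjunct alternative «`Disjoint Z (closure K) ∧ K' = closure υ₂⁻¹(K ∖ Z)`».
-/

set_option linter.dupNamespace false -- mandated namespace `Summit.<Summit>.<Problem>` of this single-conjunct summit
set_option linter.overlappingInstances false -- signatures carry `[IsDomain O] [IsDiscreteValuationRing O]`

noncomputable section

open CategoryTheory CategoryTheory.Limits AlgebraicGeometry TopologicalSpace Topology IsLocalRing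
open Literature.AlgebraicGeometry.Resolution
open AlgebraicGeometry.Scheme.IdealSheafData
open Summit.ResolutionOfSingularities.ResolutionOfSingularities.Theses.EquisingularLift.Split
open Summit.ResolutionOfSingularities.ResolutionOfSingularities.Cruxes.EquisingularLift.StrataSplit

namespace Summit.ResolutionOfSingularities.ResolutionOfSingularities.Cruxes.EquisingularLiftNat.Sections

/-! ## The trivial cone -/

/-- **The trivial cone at an explicit stage**: a running-surface datum with the shadow FORGOTTEN upgrades to the datum with shadow `K` whenever
`E` misses `closure K` — model `𝒦 := ⊤`, local trace on `V := (closure K)ᶜ`. [OURS · L1 W4.5b · T23-A engine; elementary] -/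
theorem Tower.exc₃_shadow_of_disjoint (O : Type) [CommRing O] (P : Scheme.{0}) (q : P ⟶ Spec (.of O)) (Y : Set P)
    (Ruled : Tower.RuledDatum P) {F₉ : Scheme.{0}} {Z₉ : Set F₉} {hZ₉ : IsClosed Z₉} {F₁₀ : Scheme.{0}} {υ' : F₁₀ ⟶ F₉}
    {G X : Scheme.{0}} {γ : G ⟶ F₁₀} {E K : Set G} {hE : IsClosed E} {σ : X ⟶ P} {jG : G ⟶ X}
    (h : Tower.Exc₃ O P q Y Ruled Z₉ hZ₉ υ' G γ E hE ∅ X σ jG) (hEK : Disjoint E (closure K)) :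
    Tower.Exc₃ O P q Y Ruled Z₉ hZ₉ υ' G γ E hE K X σ jG := by
  rcases h with hno | ⟨𝓔, he1, he2, he3, he4, he5, -⟩
  · exact Or.inl hno
  refine Or.inr ⟨𝓔, he1, he2, he3, he4, he5, Or.inr ⟨⊤, fun z => ?_, ?_, ?_, ?_, ?_, ?_⟩⟩
  · rw [stalkIdeal_top]; exact ⟨⟨1, by simp⟩⟩
  · let V : G.Opens := ⟨(closure K)ᶜ, isClosed_closure.isOpen_compl⟩
    refine ⟨V, hEK.subset_compl_right, ?_⟩
    rw [Scheme.IdealSheafData.comap_top, Scheme.IdealSheafData.comap_top, eq_comm, ← Scheme.IdealSheafData.support_eq_bot_iff, eq_bot_iff]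
    intro v hv
    rw [support_comap] at hv
    have hv' : (V.ι v : G) ∈ ((vanishingIdeal (⟨closure K, isClosed_closure⟩ : Closeds G)).support : Set G) := hv
    rw [Scheme.IdealSheafData.coe_support_vanishingIdeal, Scheme.Opens.ι_apply] at hv'
    exact absurd hv' v.2
  · have htop : 𝓔 ⊔ (⊤ : X.IdealSheafData) = ⊤ := sup_top_eq _
    haveI : IsEmpty (𝓔 ⊔ (⊤ : X.IdealSheafData)).subscheme := by
      rw [← (Scheme.IdealSheafData.subschemeι _).ker_eq_top_iff_isEmpty, Scheme.IdealSheafData.ker_subschemeι]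
      exact htop
    infer_instance
  · intro y hy _
    rw [sup_top_eq, Scheme.IdealSheafData.support_top] at hy
    exact absurd hy (by simp)
  · have h1 : 𝓔.comap (⊤ : X.IdealSheafData).subschemeι = ⊤ := by
      rw [← Scheme.IdealSheafData.support_eq_bot_iff, eq_bot_iff]
      intro s _
      have h2 : (⊤ : X.IdealSheafData).subschemeι s ∈ ((⊤ : X.IdealSheafData).support : Set X) := by
        rw [← Scheme.IdealSheafData.range_subschemeι]; exact ⟨s, rfl⟩
      rw [Scheme.IdealSheafData.support_top] at h2
      exact absurd h2 (by simp)
    rw [h1]; exact isEffectiveCartier_top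
  · rw [Scheme.IdealSheafData.comap_top]; exact isEffectiveCartier_top

/-- **`Tower.InvB` with the shadow forgotten ⇒ `Tower.InvB` with any shadow `K` missing the running surface** (the trivial cone).
[OURS · L1 W4.5b · T23-A engine; pure logic over `Tower.exc₃_shadow_of_disjoint`] -/
theorem Tower.invB_shadow_of_disjoint (O : Type) [CommRing O] (k : Type) [Field k] (θ : O →+* k) (P : Scheme.{0})
    (q : P ⟶ Spec (.of O)) (Y : Set P) (Ch : ∀ X' : Scheme.{0}, (X' ⟶ P) → Set X' → Prop) (Ruled : Tower.RuledDatum P)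
    (F₉ : Scheme.{0}) (Z₉ : Set F₉) (hZ₉ : IsClosed Z₉) (F₁₀ : Scheme.{0}) (υ' : F₁₀ ⟶ F₉)
    (G : Scheme.{0}) (γ : G ⟶ F₁₀) (T E : Set G) (Es : List (Set G)) (K : Set G)
    (h : Tower.InvB O k θ P q Y Ch Ruled F₉ Z₉ hZ₉ F₁₀ υ' G γ T E Es ∅) (hEK : Disjoint E (closure K)) :
    Tower.InvB O k θ P q Y Ch Ruled F₉ Z₉ hZ₉ F₁₀ υ' G γ T E Es K := by
  obtain ⟨h1, h2, h3, h4, h5, h6, h7, hEs, X, σ, S, jG, tG, hCh, hX, hXn, hXr, hdom, hsq, hTS, hE, hF'⟩ := h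
  exact ⟨h1, h2, h3, h4, h5, h6, h7, hEs, X, σ, S, jG, tG, hCh, hX, hXn, hXr, hdom, hsq, hTS,
    fun hE' => Tower.exc₃_shadow_of_disjoint O P q Y Ruled (hE hE') hEK, hF'⟩

/-! ## The rounds at the datum `FE`, from (T-k) -/

section Fact

variable (O : Type) [CommRing O] [IsDomain O] [IsDiscreteValuationRing O] (k : Type) [Field k]
    (θ : O →+* k) (hθ : Function.Surjective θ)
    (P : Scheme.{0}) [IsIntegral P] (q : P ⟶ Spec (.of O)) [IsProper q] [SmoothOfRelativeDimension 3 q] (Y : Set P)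
    (hYsp : Y ⊆ q ⁻¹' {IsLocalRing.closedPoint O}) (hYirr : IsIrreducible Y) (hYcl : IsClosed Y)
    (hPnoeth : IsLocallyNoetherian P) (hPreg : Scheme.IsRegular P)
    (Ch : ∀ X' : Scheme.{0}, (X' ⟶ P) → Set X' → Prop)
    (hChStep : ∀ (X' X'' : Scheme.{0}) (σ' : X' ⟶ P) (S' : Set X') (C : X'.IdealSheafData) (τ : X'' ⟶ X'),
      Ch X' σ' S' → IsBlowup τ C → Scheme.IsRegular C.subscheme → Flat (C.subschemeι ≫ σ' ≫ q) →
      σ' '' (C.support : Set X') ⊆ {y | ¬ IsGenericPoint y Y} → (C.support : Set X') ∩ (σ' ≫ q) ⁻¹' {IsLocalRing.closedPoint O} ⊆ S' →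
      Ch X'' (τ ≫ σ') (closure (τ ⁻¹' (S' \ (C.support : Set X')))))
    (hChSplit : ∀ (X' : Scheme.{0}) (σ' : X' ⟶ P) (S' : Set X'), Ch X' σ' S' → Chain P Y X' σ' S')

include hθ hYsp hYirr hYcl hPnoeth hPreg hChStep hChSplit

set_option maxHeartbeats 800000 in
/-- **The Čech round of `TowerRoundB` on `Tower.InvB` at the datum «`V(𝓔)` is `O`-flat», BOTH HOST MENUS, every stand-in discharged from (T-k)**
(module docstring). [OURS · L1 W4.5b · T23-A engine] toward `stub_elnat_defTowerBPointResolutionThree`; NOT a statement of the manuscript. -/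
theorem Tower.invB_embRound_of_fact_any (hFact : EmbeddedCurveLift O k θ P q) :
    ∀ {F₉ : Scheme.{0}} (Z₉ : Set F₉) (hZ₉ : IsClosed Z₉) {F₁₀ : Scheme.{0}} (υ' : F₁₀ ⟶ F₉)
    (G G' : Scheme.{0}) (γ : G ⟶ F₁₀) (T E : Set G) (Es : List (Set G)) (K H KH : Set G) (hH : IsClosed H) (Z : Set G) (hZ : IsClosed Z)
    (υ₂ : G' ⟶ G) (K' E' : Set G') (Es' : List (Set G')),
    (Tower.InvB O k θ P q Y Ch (fun _ _ _ _ _ _ _ _ _ σ _ 𝓔 => Flat (𝓔.subschemeι ≫ σ ≫ q)) F₉ Z₉ hZ₉ F₁₀ υ' G γ T E Es K ∧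
      IsClosed K ∧ K ⊆ closure (K \ E) ∧ K ≠ Set.univ) →
    ((H = E ∧ KH = K) ∨ (H ∈ Es ∧ KH = ∅)) →
    Z ⊆ H ∩ T → Z.Nonempty → TowerFull F₉ F₁₀ υ' Z₉ hZ₉ G γ Z hZ →
    (∀ x : redSub G Z hZ, IsRegularLocalRing ((redSub G Z hZ).presheaf.stalk x)) →
    (∀ (i : redSub G Z hZ ⟶ redSub G H hH), i ≫ redSubι G H hH = redSubι G Z hZ →
      ∀ x : redSub G Z hZ, IsRegularLocalRing ((redSub G H hH).presheaf.stalk (i x))) →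
    DirStepUnobs G H hH Z hZ →
    (∀ z : ↥(redSub G Z hZ), IsClosed ({z} : Set ↥(redSub G Z hZ)) → ringKrullDim ((redSub G Z hZ).presheaf.stalk z) = ((1 : ℕ) : WithBot ℕ∞)) →
    IsBlowup υ₂ (vanishingIdeal (⟨Z, hZ⟩ : Closeds G)) →
    (K' = ∅ ∨ (closure (Z \ closure KH) = Z ∧ K' = closure (υ₂ ⁻¹' (KH \ Z)))) →
    (E' = υ₂ ⁻¹' Z ∨ E' = closure (υ₂ ⁻¹' (H \ Z))) →
    (∀ F' ∈ Es', ∃ F ∈ E :: Es, RoundTransportOK υ₂ Z H F F') →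
    (Tower.InvB O k θ P q Y Ch (fun _ _ _ _ _ _ _ _ _ σ _ 𝓔 => Flat (𝓔.subschemeι ≫ σ ≫ q)) F₉ Z₉ hZ₉ F₁₀ υ' G' (υ₂ ≫ γ) (closure (υ₂ ⁻¹' (T \ Z))) E' Es' K' ∧
      IsClosed K' ∧ K' ⊆ closure (K' \ E') ∧ K' ≠ Set.univ) := by
  intro F₉ Z₉ hZ₉ F₁₀ υ' G G' γ T E Es K H KH hH Z hZ υ₂ K' E' Es' hI hhost hZHT hZne hfull hZreg hHZreg hunobs hZdim hυ₂ hK' hE' hEs'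
  obtain ⟨hinv, hKcl, hKE, hKne⟩ := hI
  obtain ⟨hυ', hZinf, hGint, hTcl, hTirr, hEcl, hTE, hEsB, X, σ, S, jG, tG, hCh, hXint, hXnoeth, hXreg, hdom, hsq, hTS, hExc, hExcF⟩ := hinv
  haveI := hGint
  haveI := hXint
  haveI := hXnoeth
  have hZH : Z ⊆ H := fun z hz => (hZHT hz).1
  have hZsupp : ((vanishingIdeal (⟨Z, hZ⟩ : Closeds G) : G.IdealSheafData).support : Set G) = Z :=
    Scheme.IdealSheafData.coe_support_vanishingIdeal _
  -- the candidates `E :: Es`, shadows forgotten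
  have hCand : ∀ F ∈ E :: Es, ∃ hF : IsClosed F, ¬ T ⊆ F ∧
      Tower.Exc₃ O P q Y (fun _ _ _ _ _ _ _ _ _ σ _ 𝓔 => Flat (𝓔.subschemeι ≫ σ ≫ q)) Z₉ hZ₉ υ' G γ F hF ∅ X σ jG := by
    intro F hF
    rcases List.mem_cons.mp hF with rfl | hF
    · exact ⟨hEcl, hTE, Tower.exc₃_forgetShadow O P q Y _ (hExc hEcl)⟩
    · exact ⟨(hEsB F hF).1, (hEsB F hF).2, hExcF F hF (hEsB F hF).1⟩
  -- the host's datum and bookkeeping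
  have hhost' : ¬ T ⊆ H ∧ Tower.Exc₃ O P q Y (fun _ _ _ _ _ _ _ _ _ σ _ 𝓔 => Flat (𝓔.subschemeι ≫ σ ≫ q)) Z₉ hZ₉ υ' G γ H hH KH X σ jG ∧
      IsClosed KH ∧ KH ⊆ closure (KH \ H) ∧ KH ≠ Set.univ := by
    rcases hhost with ⟨rfl, rfl⟩ | ⟨hmem, rfl⟩
    · exact ⟨hTE, hExc hH, hKcl, hKE, hKne⟩
    · refine ⟨(hEsB H hmem).2, hExcF H hmem hH, isClosed_empty, Set.empty_subset _, ?_⟩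
      obtain ⟨z, _⟩ := hZne
      haveI : Nonempty G := ⟨z⟩
      exact Set.empty_ne_univ
  obtain ⟨hTH, hExcH, hKHcl, hKHE, hKHne⟩ := hhost'
  have hHne : H ≠ Set.univ := fun h => hTH (h ▸ Set.subset_univ _)
  have hTZ : ¬ T ⊆ Z := fun h => hTH (h.trans hZH)
  -- the dischargers at `FE`
  have hC := Tower.hCentre_of_fact_any O k θ hθ P q Y hYsp hYirr hYcl hPnoeth hPreg Ch hChStep hChSplit hFact Z₉ hZ₉ υ' G γ T H hH Z hZ hHne
    hZH hZreg hHZreg hunobs hZdim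
  have hS := Tower.hShadow_of_any O k θ hθ P q ‹IsProper q› Y hYirr hYcl hPnoeth hPreg Ch hChSplit ‹IsIntegral P› Z₉ hZ₉ υ' G G' γ T H KH hH Z hZ
    υ₂ hυ₂
  have hSo := Tower.hShadowOld_of_any O k θ hθ P q ‹IsProper q› Y hYirr hYcl hPnoeth hPreg Ch hChSplit ‹IsIntegral P› Z₉ hZ₉ υ' G G' γ T H KH hH
    Z hZ υ₂ hυ₂
  have hBorn : ∀ (X : Scheme.{0}) (σ : X ⟶ P) (S : Set X) (jG : G ⟶ X) (tG : G ⟶ Spec (.of k)) (𝓔 𝒦₁ : X.IdealSheafData)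
      (X'' : Scheme.{0}) (τ : X'' ⟶ X) (j₂ : G' ⟶ X'') (t₂ : G' ⟶ Spec (.of k)),
      Ch X σ S → IsIntegral X → IsLocallyNoetherian X → Scheme.IsRegular X → IsDominant (σ ≫ q) →
      IsPullback jG tG (σ ≫ q) (Spec.map (CommRingCat.ofHom θ)) → jG '' T = S →
      (𝓔 ⊔ 𝒦₁).comap jG = vanishingIdeal ⟨Z, hZ⟩ → Flat ((𝓔 ⊔ 𝒦₁).subschemeι ≫ σ ≫ q) → Scheme.IsRegular (𝓔 ⊔ 𝒦₁).subscheme →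
      Scheme.IsRegular 𝓔.subscheme → IsBlowup τ (𝓔 ⊔ 𝒦₁) → IsPullback j₂ t₂ ((τ ≫ σ) ≫ q) (Spec.map (CommRingCat.ofHom θ)) →
      j₂ ≫ τ = υ₂ ≫ jG →
      Flat ((((𝓔 ⊔ 𝒦₁).comap τ)).subschemeι ≫ (τ ≫ σ) ≫ q) := by
    intro X σ S jG tG 𝓔 𝒦₁ X'' τ j₂ t₂ _ _ hXnoeth hXreg _ _ _ _ hc2 hc3 _ hτ _ _
    haveI := hXnoeth
    rw [Category.assoc]
    exact flat_exceptional_of_isBlowup_regularCentre O X X'' (σ ≫ q) (𝓔 ⊔ 𝒦₁) hXreg hc3 hc2 τ hτ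
  have hIso : ∀ (G₀ G₀' : Scheme.{0}) (γ₀ : G₀ ⟶ F₁₀) (γ₀' : G₀' ⟶ F₁₀) (E₀ : Set G₀) (E₀' : Set G₀') (X₀ X₀'' : Scheme.{0})
      (σ₀ : X₀ ⟶ P) (j₀ : G₀ ⟶ X₀) (j₀' : G₀' ⟶ X₀'') (𝓔₀ : X₀.IdealSheafData) (𝓔₀' : X₀''.IdealSheafData) (τ₀ : X₀'' ⟶ X₀),
      (∃ e : 𝓔₀'.subscheme ≅ 𝓔₀.subscheme, e.hom ≫ 𝓔₀.subschemeι = 𝓔₀'.subschemeι ≫ τ₀) →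
      (fun _ _ _ _ _ _ _ _ _ σ _ 𝓔 => Flat (𝓔.subschemeι ≫ σ ≫ q)) F₉ Z₉ hZ₉ F₁₀ υ' G₀ γ₀ E₀ X₀ σ₀ j₀ 𝓔₀ →
      (fun _ _ _ _ _ _ _ _ _ σ _ 𝓔 => Flat (𝓔.subschemeι ≫ σ ≫ q)) F₉ Z₉ hZ₉ F₁₀ υ' G₀' γ₀' E₀' X₀'' (τ₀ ≫ σ₀) j₀' 𝓔₀' := by
    intro G₀ G₀' γ₀ γ₀' E₀ E₀' X₀ X₀'' σ₀ j₀ j₀' 𝓔₀ 𝓔₀' τ₀ he hflat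
    obtain ⟨e, he⟩ := he
    have hflat' : Flat (𝓔₀.subschemeι ≫ σ₀ ≫ q) := hflat
    have heq : 𝓔₀'.subschemeι ≫ (τ₀ ≫ σ₀) ≫ q = e.hom ≫ 𝓔₀.subschemeι ≫ σ₀ ≫ q := by
      rw [← Category.assoc e.hom, he]; simp only [Category.assoc]
    show Flat (𝓔₀'.subschemeι ≫ (τ₀ ≫ σ₀) ≫ q)
    rw [heq]
    infer_instance
  -- the core
  have hB := Tower.invB_embRoundCore O k θ hθ P q Y hYirr hYcl hPnoeth hPreg Ch hChSplit hChStep _ Z₉ hZ₉ υ' hIso G G' γ T H KH (E :: Es)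
    hH Z hZ υ₂ hυ' hZinf hTirr hTH X σ S jG tG hCh hXreg hdom hsq hTS hExcH hCand hZHT hfull hυ₂ hKHcl hKHE hKHne hC hS hSo hBorn K' E'
    Es' hK' hE' hEs'
  have hG'int : IsIntegral G' := hB.2.2.1
  haveI := hG'int
  -- the side facts of `K'`
  rcases hK' with rfl | ⟨-, rfl⟩
  · exact ⟨hB, isClosed_empty, Set.empty_subset _, Set.empty_ne_univ⟩
  · have hne : closure (υ₂ ⁻¹' (KH \ Z)) ≠ Set.univ :=
      closure_preimage_ne_univ υ₂ _ hυ₂ KH Z hKHcl hKHne hZ (fun h => hTZ (h ▸ Set.subset_univ _)) hZsupp.le _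
        (Set.preimage_mono fun z hz => hz.1)
    refine ⟨hB, isClosed_closure, ?_, hne⟩
    rcases hE' with rfl | rfl
    · exact closure_preimage_diff_subset_closure_diff_preimage υ₂ KH Z
    · have h := closure_preimage_diff_subset_of_isBlowup υ₂ (vanishingIdeal (⟨Z, hZ⟩ : Closeds G)) hυ₂ KH H hH hKHE
      rw [hZsupp] at h
      exact h

omit [IsIntegral P] [SmoothOfRelativeDimension 3 q] hYsp in
set_option maxHeartbeats 800000 in
/-- **The cone-witnessed round of `TowerRoundB` on `Tower.InvB` at the datum «`V(𝓔)` is `O`-flat»** (host = the running surface), stand-ins discharged.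
[OURS · L1 W4.5b · T23-A engine] toward `stub_elnat_defTowerBPointResolutionThree`; NOT a statement of the manuscript. -/
theorem Tower.invB_coneRound_of_any :
    ∀ {F₉ : Scheme.{0}} (Z₉ : Set F₉) (hZ₉ : IsClosed Z₉) {F₁₀ : Scheme.{0}} (υ' : F₁₀ ⟶ F₉)
    (G G' : Scheme.{0}) (γ : G ⟶ F₁₀) (T E : Set G) (Es : List (Set G)) (K : Set G) (hE : IsClosed E) (Z : Set G) (hZ : IsClosed Z)
    (υ₂ : G' ⟶ G) (K' E' : Set G') (Es' : List (Set G')),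
    (Tower.InvB O k θ P q Y Ch (fun _ _ _ _ _ _ _ _ _ σ _ 𝓔 => Flat (𝓔.subschemeι ≫ σ ≫ q)) F₉ Z₉ hZ₉ F₁₀ υ' G γ T E Es K ∧
      IsClosed K ∧ K ⊆ closure (K \ E) ∧ K ≠ Set.univ) →
    Z ⊆ E ∩ T → Z.Nonempty → TowerFull F₉ F₁₀ υ' Z₉ hZ₉ G γ Z hZ → ConeWitness G E hE K Z hZ →
    IsBlowup υ₂ (vanishingIdeal (⟨Z, hZ⟩ : Closeds G)) →
    (K' = ∅ ∨ K' = closure (υ₂ ⁻¹' (K \ Z))) →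
    (E' = υ₂ ⁻¹' Z ∨ E' = closure (υ₂ ⁻¹' (E \ Z))) →
    (∀ F' ∈ Es', ∃ F ∈ E :: Es, RoundTransportOK υ₂ Z E F F') →
    (Tower.InvB O k θ P q Y Ch (fun _ _ _ _ _ _ _ _ _ σ _ 𝓔 => Flat (𝓔.subschemeι ≫ σ ≫ q)) F₉ Z₉ hZ₉ F₁₀ υ' G' (υ₂ ≫ γ) (closure (υ₂ ⁻¹' (T \ Z))) E' Es' K' ∧
      IsClosed K' ∧ K' ⊆ closure (K' \ E') ∧ K' ≠ Set.univ) := by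
  intro F₉ Z₉ hZ₉ F₁₀ υ' G G' γ T E Es K hE Z hZ υ₂ K' E' Es' hI hZET hZne hfull hcone hυ₂ hK' hE' hEs'
  obtain ⟨hinv, hKcl, hKE, hKne⟩ := hI
  have hZE : Z ⊆ E := fun z hz => (hZET hz).1
  have hEZ : E ⊆ closure (E \ Z) :=
    Tower.subset_closure_diff_of_inv₃_coneWitness O k θ hθ P q Y Ch _ Z₉ hZ₉ υ' G γ T E K hE Z hZ
      (Tower.invB_inv₃ O k θ P q Y Ch _ F₉ Z₉ hZ₉ F₁₀ υ' G γ T E Es K hinv) hfull hZE hcone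
  obtain ⟨hυ', hZinf, hGint, hTcl, hTirr, hEcl, hTE, hEsB, X, σ, S, jG, tG, hCh, hXint, hXnoeth, hXreg, hdom, hsq, hTS, hExc, hExcF⟩ := hinv
  haveI := hGint
  haveI := hXint
  haveI := hXnoeth
  have hTZ : ¬ T ⊆ Z := fun h => hTE (h.trans hZE)
  have hZsupp : ((vanishingIdeal (⟨Z, hZ⟩ : Closeds G) : G.IdealSheafData).support : Set G) = Z :=
    Scheme.IdealSheafData.coe_support_vanishingIdeal _
  have hCand : ∀ F ∈ E :: Es, ∃ hF : IsClosed F, ¬ T ⊆ F ∧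
      Tower.Exc₃ O P q Y (fun _ _ _ _ _ _ _ _ _ σ _ 𝓔 => Flat (𝓔.subschemeι ≫ σ ≫ q)) Z₉ hZ₉ υ' G γ F hF ∅ X σ jG := by
    intro F hF
    rcases List.mem_cons.mp hF with rfl | hF
    · exact ⟨hEcl, hTE, Tower.exc₃_forgetShadow O P q Y _ (hExc hEcl)⟩
    · exact ⟨(hEsB F hF).1, (hEsB F hF).2, hExcF F hF (hEsB F hF).1⟩
  have hBorn : ∀ (X : Scheme.{0}) (σ : X ⟶ P) (S : Set X) (jG : G ⟶ X) (tG : G ⟶ Spec (.of k)) (𝓔 𝒦 : X.IdealSheafData)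
      (X'' : Scheme.{0}) (τ : X'' ⟶ X) (j₂ : G' ⟶ X'') (t₂ : G' ⟶ Spec (.of k)),
      Ch X σ S → IsIntegral X → IsLocallyNoetherian X → Scheme.IsRegular X → IsDominant (σ ≫ q) →
      IsPullback jG tG (σ ≫ q) (Spec.map (CommRingCat.ofHom θ)) → jG '' T = S →
      (𝓔 ⊔ 𝒦).comap jG = vanishingIdeal ⟨Z, hZ⟩ → Flat ((𝓔 ⊔ 𝒦).subschemeι ≫ σ ≫ q) → Scheme.IsRegular (𝓔 ⊔ 𝒦).subscheme →
      Scheme.IsRegular 𝓔.subscheme → IsBlowup τ (𝓔 ⊔ 𝒦) → IsPullback j₂ t₂ ((τ ≫ σ) ≫ q) (Spec.map (CommRingCat.ofHom θ)) →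
      j₂ ≫ τ = υ₂ ≫ jG →
      Flat ((((𝓔 ⊔ 𝒦).comap τ)).subschemeι ≫ (τ ≫ σ) ≫ q) := by
    intro X σ S jG tG 𝓔 𝒦 X'' τ j₂ t₂ _ _ hXnoeth hXreg _ _ _ _ hc2 hc3 _ hτ _ _
    haveI := hXnoeth
    rw [Category.assoc]
    exact flat_exceptional_of_isBlowup_regularCentre O X X'' (σ ≫ q) (𝓔 ⊔ 𝒦) hXreg hc3 hc2 τ hτ
  have hIso : ∀ (G₀ G₀' : Scheme.{0}) (γ₀ : G₀ ⟶ F₁₀) (γ₀' : G₀' ⟶ F₁₀) (E₀ : Set G₀) (E₀' : Set G₀') (X₀ X₀'' : Scheme.{0})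
      (σ₀ : X₀ ⟶ P) (j₀ : G₀ ⟶ X₀) (j₀' : G₀' ⟶ X₀'') (𝓔₀ : X₀.IdealSheafData) (𝓔₀' : X₀''.IdealSheafData) (τ₀ : X₀'' ⟶ X₀),
      (∃ e : 𝓔₀'.subscheme ≅ 𝓔₀.subscheme, e.hom ≫ 𝓔₀.subschemeι = 𝓔₀'.subschemeι ≫ τ₀) →
      (fun _ _ _ _ _ _ _ _ _ σ _ 𝓔 => Flat (𝓔.subschemeι ≫ σ ≫ q)) F₉ Z₉ hZ₉ F₁₀ υ' G₀ γ₀ E₀ X₀ σ₀ j₀ 𝓔₀ →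
      (fun _ _ _ _ _ _ _ _ _ σ _ 𝓔 => Flat (𝓔.subschemeι ≫ σ ≫ q)) F₉ Z₉ hZ₉ F₁₀ υ' G₀' γ₀' E₀' X₀'' (τ₀ ≫ σ₀) j₀' 𝓔₀' := by
    intro G₀ G₀' γ₀ γ₀' E₀ E₀' X₀ X₀'' σ₀ j₀ j₀' 𝓔₀ 𝓔₀' τ₀ he hflat
    obtain ⟨e, he⟩ := he
    have hflat' : Flat (𝓔₀.subschemeι ≫ σ₀ ≫ q) := hflat
    have heq : 𝓔₀'.subschemeι ≫ (τ₀ ≫ σ₀) ≫ q = e.hom ≫ 𝓔₀.subschemeι ≫ σ₀ ≫ q := by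
      rw [← Category.assoc e.hom, he]; simp only [Category.assoc]
    show Flat (𝓔₀'.subschemeι ≫ (τ₀ ≫ σ₀) ≫ q)
    rw [heq]
    infer_instance
  have hB := Tower.invB_coneRoundCore O k θ hθ P q Y hYirr hYcl hPnoeth hPreg Ch hChSplit hChStep _ Z₉ hZ₉ υ' hIso G G' γ T E K (E :: Es)
    hE Z hZ υ₂ hυ' hZinf hTirr hTE X σ S jG tG hCh hXreg hdom hsq hTS (hExc hE) hCand hZET hZne hfull hcone hυ₂ hKcl hKE hKne hEZ hBorn
    K' E' Es' hK' hE' hEs'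
  have hG'int : IsIntegral G' := hB.2.2.1
  haveI := hG'int
  rcases hK' with rfl | rfl
  · exact ⟨hB, isClosed_empty, Set.empty_subset _, Set.empty_ne_univ⟩
  · have hne : closure (υ₂ ⁻¹' (K \ Z)) ≠ Set.univ :=
      closure_preimage_ne_univ υ₂ _ hυ₂ K Z hKcl hKne hZ (fun h => hTZ (h ▸ Set.subset_univ _)) hZsupp.le _
        (Set.preimage_mono fun z hz => hz.1)
    refine ⟨hB, isClosed_closure, ?_, hne⟩
    rcases hE' with rfl | rfl
    · exact closure_preimage_diff_subset_closure_diff_preimage υ₂ K Z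
    · have h := closure_preimage_diff_subset_of_isBlowup υ₂ (vanishingIdeal (⟨Z, hZ⟩ : Closeds G)) hυ₂ K E hE hKE
      rw [hZsupp] at h
      exact h

end Fact

end Summit.ResolutionOfSingularities.ResolutionOfSingularities.Cruxes.EquisingularLiftNat.Sections

end
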